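import Mathlib.Analysis.Complex.CoveringMap
import Mathlib.Analysis.Convex.Contractible
import Mathlib.Analysis.SpecialFunctions.Complex.Log
import Mathlib.AlgebraicTopology.FundamentalGroupoid.FundamentalGroup
import Mathlib.AlgebraicTopology.FundamentalGroupoid.SimplyConnected
import Mathlib.Topology.Homotopy.Lifting
import Mathlib.Topology.Homotopy.Product
import HarnessLib

/-!
# The fundamental group of the punctured plane is generated by the winding loop

Trunk T-ALGTOP (fundamental group). Real proofs of the classical facts

* `Literature.AlgebraicTopology.FundamentalGroup.PuncturedPlane.exists_homotopic_windingLoop`: every loop of `ℂ ∖ {0}` based at a point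
  `r > 0` of the positive real axis is homotopic to a *winding loop* `t ↦ r e^{2π i m t}` for some
  `m ∈ ℤ`;
* `Literature.AlgebraicTopology.FundamentalGroup.PuncturedPlane.fromPath_mem_zpowers`: hence `π₁(ℂ ∖ {0}, r)` is the cyclic group generated
  by the class of `t ↦ r e^{2π i t}` (Hatcher, *Algebraic Topology*, Thm. 1.7: `π₁(S¹)` is
  infinite cyclic generated by `ω(s) = (cos 2πs, sin 2πs)`; only generation is proved here, which
  is what the knot-theoretic applications need);
* `Literature.AlgebraicTopology.FundamentalGroup.PuncturedPlane.fromPath_eq_map_slice`, `Literature.AlgebraicTopology.FundamentalGroup.PuncturedPlane.fromPath_mem_zpowers_slice`: in a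
  product `S × (ℂ ∖ {0})` with `S` simply connected, the class of every loop at `(s₀, r)` is a power
  of the class of the winding loop of the slice `{s₀} × (ℂ ∖ {0})`.

## Proof

`exp : ℂ → ℂ ∖ {0}` is a covering map (Mathlib, `Complex.isCoveringMap_exp`); lift a loop `β` at
`r` to a path in `ℂ` starting at `log r` (`IsCoveringMap.liftPath`); its endpoint is
`log r + 2π i m` for some `m ∈ ℤ` (`Complex.exp_eq_exp_iff_exists_int`); since `ℂ` is simply
connected (a real topological vector space is contractible) the lift is homotopic rel endpoints to
the straight segment, whose image under `exp` is the winding loop `w_m`. The relations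
`[w_{m+1}] = [w_1] · [w_m]`, `[w_{m-1}] = [w_1]⁻¹ · [w_m]` follow in the same way by comparing
straight segments, and an induction over `ℤ` gives `[w_m] ∈ ⟨[w_1]⟩`. For the product, a loop of
`S × C` is the product of its projections (`Path.Homotopic.prod`), and the first projection is
null-homotopic.

## Sources

* A. Hatcher, *Algebraic Topology* (2002), §1.1, Thm. 1.7 (and §1.3, Prop. 1.30, the lifting
  properties of covering spaces) [HatcherAT2002].
* Mathlib: `Complex.isCoveringMap_exp` (`Mathlib.Analysis.Complex.CoveringMap`),
  `IsCoveringMap.liftPath` (`Mathlib.Topology.Homotopy.Lifting`), `Path.Homotopic.prod`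
  (`Mathlib.Topology.Homotopy.Product`), `SimplyConnectedSpace.paths_homotopic`. Mathlib has the
  monodromy machinery (`IsQuotientCoveringMap.fundamentalGroupEquiv`) but no statement identifying
  a generator of `π₁(ℂ ∖ {0})` or `π₁(S¹)` by an explicit loop (searched `windingNumber`,
  `fundamentalGroup` + `Circle`, `zpowers` in `Topology/Homotopy`).

## Design notes

* The punctured plane is the subtype `{z : ℂ // z ≠ 0}` (`CStar`), the codomain of Mathlib's
  `Complex.isCoveringMap_exp`; base points are the positive reals `bpt r`, which is what tubular
  neighbourhood fibres `r • (cos θ, sin θ)` produce.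
* No declaration in this file uses `sorry`.
-/

noncomputable section

open Complex hiding I
open Set Function unitInterval Topology

namespace Literature.AlgebraicTopology.FundamentalGroup

namespace PuncturedPlane

/-- The punctured complex plane `ℂ ∖ {0}` as a subtype. [folklore] -/
abbrev CStar : Type := {z : ℂ // z ≠ 0}

/-- The exponential covering map `ℂ → ℂ ∖ {0}`. [folklore] -/
def expCover (z : ℂ) : CStar := ⟨exp z, exp_ne_zero z⟩

/-- Values of `expCover`. [folklore] -/
@[simp] theorem expCover_coe (z : ℂ) : (expCover z : ℂ) = exp z := rfl

/-- `expCover` is continuous. [folklore] -/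
theorem continuous_expCover : Continuous expCover :=
  continuous_exp.subtype_mk _

/-- `exp : ℂ → ℂ ∖ {0}` is a covering map (Mathlib's `Complex.isCoveringMap_exp`).
[cite: HatcherAT2002, §1.3] -/
theorem isCoveringMap_expCover : IsCoveringMap expCover := Complex.isCoveringMap_exp

/-- The base point `r > 0` of the punctured plane. [folklore] -/
def bpt (r : ℝ) (hr : 0 < r) : CStar := ⟨r, ofReal_ne_zero.2 hr.ne'⟩

/-- Value of the base point. [folklore] -/
@[simp] theorem bpt_coe (r : ℝ) (hr : 0 < r) : (bpt r hr : ℂ) = r := rfl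

/-- `e^{2π i m} = 1`. [folklore] -/
theorem exp_winding (m : ℤ) : exp (((2 * Real.pi * m : ℝ) : ℂ) * Complex.I) = 1 := by
  have : (((2 * Real.pi * m : ℝ) : ℂ) * Complex.I) = m * (2 * Real.pi * Complex.I) := by
    push_cast
    ring
  rw [this, exp_int_mul_two_pi_mul_I]

/-- **The winding loop** `t ↦ r e^{2π i m t}` of the punctured plane, based at `r` (Hatcher's
`ω` for `m = 1`, up to the radius). [cite: HatcherAT2002, Thm. 1.7] -/
def windingLoop (r : ℝ) (hr : 0 < r) (m : ℤ) : Path (bpt r hr) (bpt r hr) where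
  toFun t := ⟨r * exp (((2 * Real.pi * m * t : ℝ) : ℂ) * Complex.I),
    mul_ne_zero (ofReal_ne_zero.2 hr.ne') (exp_ne_zero _)⟩
  continuous_toFun := by
    apply Continuous.subtype_mk
    fun_prop
  source' := by
    apply Subtype.ext
    simp
  target' := by
    apply Subtype.ext
    simp only [Set.Icc.coe_one, mul_one, bpt_coe]
    rw [exp_winding, mul_one]

/-- Values of the winding loop. [folklore] -/
theorem windingLoop_apply_coe (r : ℝ) (hr : 0 < r) (m : ℤ) (t : I) :
    (windingLoop r hr m t : ℂ) = r * exp (((2 * Real.pi * m * t : ℝ) : ℂ) * Complex.I) := rfl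

/-- The straight path in `ℂ` from `a` to `a + m · 2πi`, `t ↦ a + t m · 2πi` (the lift of the
winding loop). [folklore] -/
def liftSeg (a : ℂ) (m : ℤ) : Path a (a + m * (2 * Real.pi * Complex.I)) where
  toFun t := a + ((2 * Real.pi * m * t : ℝ) : ℂ) * Complex.I
  continuous_toFun := by fun_prop
  source' := by simp
  target' := by
    simp only [Set.Icc.coe_one, mul_one]
    push_cast
    ring

/-- The straight path from `log r` lifts the winding loop. [folklore] -/
theorem expCover_liftSeg (r : ℝ) (hr : 0 < r) (m : ℤ) (t : I) :
    expCover (liftSeg (Real.log r : ℂ) m t) = windingLoop r hr m t := by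
  apply Subtype.ext
  simp only [expCover_coe, liftSeg, Path.coe_mk_mk, windingLoop_apply_coe, exp_add,
    ← ofReal_exp, Real.exp_log hr]

/-- `exp (log r) = r` in the punctured plane. [folklore] -/
theorem expCover_log (r : ℝ) (hr : 0 < r) : expCover (Real.log r : ℂ) = bpt r hr := by
  apply Subtype.ext
  simp [← ofReal_exp, Real.exp_log hr]

/-- `exp (log r + 2π i m) = r` in the punctured plane. [folklore] -/
theorem expCover_log_add (r : ℝ) (hr : 0 < r) (m : ℤ) :
    expCover ((Real.log r : ℂ) + m * (2 * Real.pi * Complex.I)) = bpt r hr := by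
  apply Subtype.ext
  simp [exp_add, ← ofReal_exp, Real.exp_log hr, exp_int_mul_two_pi_mul_I]

/-- **Every loop of `ℂ ∖ {0}` at `r` is homotopic to a winding loop** (lift through `exp`, which is
a covering map, and use that `ℂ` is simply connected). [cite: HatcherAT2002, Thm. 1.7 (proof)] -/
theorem exists_homotopic_windingLoop (r : ℝ) (hr : 0 < r) (β : Path (bpt r hr) (bpt r hr)) :
    ∃ m : ℤ, β.Homotopic (windingLoop r hr m) := by
  have cov := isCoveringMap_expCover
  set e₀ : ℂ := (Real.log r : ℂ) with he₀
  have h0 : β.toContinuousMap 0 = expCover e₀ := by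
    rw [expCover_log r hr]
    exact β.source
  set Γ := cov.liftPath β.toContinuousMap e₀ h0 with hΓ
  have hlift : ∀ t, expCover (Γ t) = β t := fun t =>
    congr_fun (cov.liftPath_lifts β.toContinuousMap e₀ h0) t
  have hΓ0 : Γ 0 = e₀ := cov.liftPath_zero β.toContinuousMap e₀ h0
  -- the endpoint of the lift lies over the base point
  have hend : exp (Γ 1) = exp e₀ := by
    have h1 := congrArg Subtype.val (hlift 1)
    rw [expCover_coe, β.target] at h1
    rw [h1, he₀, ← ofReal_exp, Real.exp_log hr]
    rfl
  obtain ⟨m, hm⟩ := exp_eq_exp_iff_exists_int.1 hend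
  refine ⟨m, ?_⟩
  let Γp : Path e₀ (e₀ + m * (2 * Real.pi * Complex.I)) :=
    { toFun := Γ
      continuous_toFun := Γ.continuous
      source' := hΓ0
      target' := hm }
  have hhom : Γp.Homotopic (liftSeg e₀ m) := SimplyConnectedSpace.paths_homotopic _ _
  have hmap := hhom.map ⟨expCover, continuous_expCover⟩
  have hx : bpt r hr = expCover e₀ := (expCover_log r hr).symm
  have hy : bpt r hr = expCover (e₀ + m * (2 * Real.pi * Complex.I)) := (expCover_log_add r hr m).symm
  have hc := hmap.pathCast hx hy
  have e1 : (Γp.map continuous_expCover).cast hx hy = β := by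
    ext t
    exact congrArg Subtype.val (hlift t)
  have e2 : ((liftSeg e₀ m).map continuous_expCover).cast hx hy = windingLoop r hr m := by
    ext t
    exact congrArg Subtype.val (expCover_liftSeg r hr m t)
  rw [e1, e2] at hc
  exact hc

/-- The winding loops satisfy `[w_{m+1}] = [w_1] · [w_m]` and `[w_{m-1}] = [w_1]⁻¹ · [w_m]`;
hence all their classes lie in the cyclic subgroup generated by `[w_1]`. [folklore] -/
theorem windingLoop_mem_zpowers (r : ℝ) (hr : 0 < r) (m : ℤ) :
    (FundamentalGroup.fromPath (Path.Homotopic.Quotient.mk (windingLoop r hr m)) :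
        FundamentalGroup CStar (bpt r hr)) ∈
      Subgroup.zpowers (FundamentalGroup.fromPath
        (Path.Homotopic.Quotient.mk (windingLoop r hr 1))) := by
  set e₀ : ℂ := (Real.log r : ℂ) with he₀
  set g : FundamentalGroup CStar (bpt r hr) :=
    FundamentalGroup.fromPath (Path.Homotopic.Quotient.mk (windingLoop r hr 1)) with hg
  -- the class of `w_m` as the image of the straight lift
  have hx : bpt r hr = expCover e₀ := (expCover_log r hr).symm
  have key : ∀ (m : ℤ) (S : Path e₀ (e₀ + m * (2 * Real.pi * Complex.I))),
      Path.Homotopic.Quotient.mk (windingLoop r hr m) =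
        Path.Homotopic.Quotient.mk ((S.map continuous_expCover).cast hx
          (expCover_log_add r hr m).symm) := by
    intro m S
    have hhom : (liftSeg e₀ m).Homotopic S := SimplyConnectedSpace.paths_homotopic _ _
    have hc := (hhom.map ⟨expCover, continuous_expCover⟩).pathCast hx
      (expCover_log_add r hr m).symm
    have e2 : ((liftSeg e₀ m).map continuous_expCover).cast hx (expCover_log_add r hr m).symm =
        windingLoop r hr m := by
      ext t
      exact congrArg Subtype.val (expCover_liftSeg r hr m t)
    rw [e2] at hc
    exact Path.Homotopic.Quotient.eq.2 hc
  -- one step up: the segment to level `m`, then one more turn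
  have up : ∀ m : ℤ, Path.Homotopic.Quotient.mk (windingLoop r hr (m + 1)) =
      (Path.Homotopic.Quotient.mk (windingLoop r hr m)).trans
        (Path.Homotopic.Quotient.mk (windingLoop r hr 1)) := by
    intro m
    let S' : Path (e₀ + m * (2 * Real.pi * Complex.I)) (e₀ + (m + 1 : ℤ) * (2 * Real.pi * Complex.I)) :=
      { toFun := fun t => e₀ + m * (2 * Real.pi * Complex.I) + ((2 * Real.pi * 1 * t : ℝ) : ℂ) * Complex.I
        continuous_toFun := by fun_prop
        source' := by simp
        target' := by
          simp only [Set.Icc.coe_one, mul_one]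
          push_cast
          ring }
    have hS' : ∀ t, expCover (S' t) = windingLoop r hr 1 t := by
      intro t
      apply Subtype.ext
      simp only [expCover_coe, S', Path.coe_mk_mk, windingLoop_apply_coe, exp_add, he₀,
        ← ofReal_exp, Real.exp_log hr, exp_int_mul_two_pi_mul_I, mul_one, Int.cast_one]
    rw [key (m + 1) ((liftSeg e₀ m).trans S'), ← Path.Homotopic.Quotient.mk_trans]
    congr 1
    ext t
    rw [Path.cast_coe, Path.map_coe, Function.comp_apply, Path.trans_apply, Path.trans_apply]
    split_ifs with h
    · exact congrArg Subtype.val (expCover_liftSeg r hr m _)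
    · exact congrArg Subtype.val (hS' _)
  -- one step down
  have down : ∀ m : ℤ, Path.Homotopic.Quotient.mk (windingLoop r hr (m - 1)) =
      (Path.Homotopic.Quotient.mk (windingLoop r hr m)).trans
        (Path.Homotopic.Quotient.mk (windingLoop r hr 1)).symm := by
    intro m
    let S' : Path (e₀ + m * (2 * Real.pi * Complex.I)) (e₀ + (m - 1 : ℤ) * (2 * Real.pi * Complex.I)) :=
      { toFun := fun t => e₀ + m * (2 * Real.pi * Complex.I) - ((2 * Real.pi * 1 * t : ℝ) : ℂ) * Complex.I
        continuous_toFun := by fun_prop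
        source' := by simp
        target' := by
          simp only [Set.Icc.coe_one, mul_one]
          push_cast
          ring }
    have hS' : ∀ t, expCover (S' t) = (windingLoop r hr 1).symm t := by
      intro t
      apply Subtype.ext
      change (expCover (S' t) : ℂ) = (windingLoop r hr 1 (σ t) : ℂ)
      rw [windingLoop_apply_coe, expCover_coe]
      simp only [S', Path.coe_mk_mk, unitInterval.coe_symm_eq]
      rw [sub_eq_add_neg, exp_add, exp_add, he₀, ← ofReal_exp, Real.exp_log hr,
        exp_int_mul_two_pi_mul_I, mul_one]
      congr 1
      have harg : ((2 * Real.pi * ((1 : ℤ) : ℝ) * (1 - (t : ℝ)) : ℝ) : ℂ) * Complex.I =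
          -(((2 * Real.pi * 1 * (t : ℝ) : ℝ) : ℂ) * Complex.I) + 2 * Real.pi * Complex.I := by
        push_cast
        ring
      rw [harg, exp_add, exp_two_pi_mul_I]
      simp only [mul_one]
    rw [key (m - 1) ((liftSeg e₀ m).trans S'), ← Path.Homotopic.Quotient.mk_symm,
      ← Path.Homotopic.Quotient.mk_trans]
    congr 1
    ext t
    rw [Path.cast_coe, Path.map_coe, Function.comp_apply, Path.trans_apply, Path.trans_apply]
    split_ifs with h
    · exact congrArg Subtype.val (expCover_liftSeg r hr m _)
    · exact congrArg Subtype.val (hS' _)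
  -- induction over `ℤ`
  induction m using Int.induction_on with
  | zero =>
    have h0 : windingLoop r hr 0 = Path.refl (bpt r hr) := by
      ext t
      simp [windingLoop_apply_coe]
    rw [h0, Path.Homotopic.Quotient.mk_refl, ← FundamentalGroup.one_def]
    exact one_mem _
  | succ m ih =>
    have : (FundamentalGroup.fromPath (Path.Homotopic.Quotient.mk (windingLoop r hr (m + 1))) :
        FundamentalGroup CStar (bpt r hr)) =
        g * FundamentalGroup.fromPath (Path.Homotopic.Quotient.mk (windingLoop r hr m)) := by
      rw [FundamentalGroup.mul_def, hg]
      exact up m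
    rw [this]
    exact mul_mem (Subgroup.mem_zpowers g) ih
  | pred m ih =>
    have : (FundamentalGroup.fromPath (Path.Homotopic.Quotient.mk (windingLoop r hr (-m - 1))) :
        FundamentalGroup CStar (bpt r hr)) =
        g⁻¹ * FundamentalGroup.fromPath (Path.Homotopic.Quotient.mk (windingLoop r hr (-m))) := by
      rw [FundamentalGroup.mul_def, FundamentalGroup.inv_def, hg]
      exact down (-m)
    rw [this]
    exact mul_mem (inv_mem (Subgroup.mem_zpowers g)) ih

/-- **`π₁(ℂ ∖ {0}, r)` is generated by the winding loop `t ↦ r e^{2π i t}`** (Hatcher,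
*Algebraic Topology*, Thm. 1.7 for `S¹`, via the covering `exp : ℂ → ℂ ∖ {0}`; generation half).
[cite: HatcherAT2002, Thm. 1.7] -/
theorem fromPath_mem_zpowers (r : ℝ) (hr : 0 < r) (β : Path (bpt r hr) (bpt r hr)) :
    (FundamentalGroup.fromPath (Path.Homotopic.Quotient.mk β) : FundamentalGroup CStar (bpt r hr)) ∈
      Subgroup.zpowers (FundamentalGroup.fromPath
        (Path.Homotopic.Quotient.mk (windingLoop r hr 1))) := by
  obtain ⟨m, hm⟩ := exists_homotopic_windingLoop r hr β
  rw [Path.Homotopic.Quotient.eq.2 hm]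
  exact windingLoop_mem_zpowers r hr m

/-! ### Products with a simply connected factor -/

/-- In `S × C` with `S` simply connected, the class of a loop at `(s₀, c)` is the image under the
slice inclusion `x ↦ (s₀, x)` of the class of its second projection. [folklore] -/
theorem fromPath_eq_map_slice {S C : Type*} [TopologicalSpace S] [TopologicalSpace C]
    [SimplyConnectedSpace S] (s₀ : S) (c : C) (β : Path (s₀, c) (s₀, c)) :
    (FundamentalGroup.fromPath (Path.Homotopic.Quotient.mk β) : FundamentalGroup (S × C) (s₀, c)) =
      FundamentalGroup.map (⟨fun x => (s₀, x), by fun_prop⟩ : C(C, S × C)) c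
        (FundamentalGroup.fromPath (Path.Homotopic.Quotient.mk (β.map continuous_snd))) := by
  have h1 : (β.map continuous_fst).Homotopic (Path.refl s₀) :=
    SimplyConnectedSpace.paths_homotopic _ _
  have e : β = (β.map continuous_fst).prod (β.map continuous_snd) := by
    ext t <;> rfl
  have e' : (Path.refl s₀).prod (β.map continuous_snd) =
      (β.map continuous_snd).map (⟨fun x => (s₀, x), by fun_prop⟩ : C(C, S × C)).continuous := by
    ext t <;> rfl
  conv_lhs => rw [e]
  rw [← Path.Homotopic.prod_lift, Path.Homotopic.Quotient.eq.2 h1,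
    Path.Homotopic.prod_lift, e', Path.Homotopic.Quotient.mk_map]
  rfl

/-- The winding loop in the slice `{s₀} × (ℂ ∖ {0})`. [folklore] -/
def sliceWindingLoop {S : Type*} [TopologicalSpace S] (s₀ : S) (r : ℝ) (hr : 0 < r) :
    Path (s₀, bpt r hr) (s₀, bpt r hr) :=
  (windingLoop r hr 1).map
    ((⟨fun x => (s₀, x), by fun_prop⟩ : C(CStar, S × CStar)).continuous)

/-- Values of the slice winding loop. [folklore] -/
theorem sliceWindingLoop_apply {S : Type*} [TopologicalSpace S] (s₀ : S) (r : ℝ) (hr : 0 < r)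
    (t : I) : sliceWindingLoop s₀ r hr t = (s₀, windingLoop r hr 1 t) := rfl

/-- **Loops of `S × (ℂ ∖ {0})`, `S` simply connected, are powers of the slice winding loop.**
[folklore] -/
theorem fromPath_mem_zpowers_slice {S : Type*} [TopologicalSpace S] [SimplyConnectedSpace S]
    (s₀ : S) (r : ℝ) (hr : 0 < r) (β : Path (s₀, bpt r hr) (s₀, bpt r hr)) :
    (FundamentalGroup.fromPath (Path.Homotopic.Quotient.mk β) :
        FundamentalGroup (S × CStar) (s₀, bpt r hr)) ∈
      Subgroup.zpowers (FundamentalGroup.fromPath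
        (Path.Homotopic.Quotient.mk (sliceWindingLoop s₀ r hr))) := by
  rw [fromPath_eq_map_slice s₀ (bpt r hr) β]
  obtain ⟨k, hk⟩ := Subgroup.mem_zpowers_iff.1 (fromPath_mem_zpowers r hr (β.map continuous_snd))
  rw [← hk, map_zpow]
  refine Subgroup.zpow_mem _ (Subgroup.mem_zpowers_iff.2 ⟨1, ?_⟩) k
  rw [zpow_one]
  rfl

end PuncturedPlane

end Literature.AlgebraicTopology.FundamentalGroup
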